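import Summits.ResolutionOfSingularities.ResolutionOfSingularities.Theorems.PAlterationPicoverTowerTransport
import Mathlib.FieldTheory.PurelyInseparable.Exponent
import HarnessLib

/-!
# Stub `stub_degP_of_core` (crux stmt-ResolutionOfSingularities-0552, line `Sketch` rev c2)

The ENTRY of the quotient chain over a perfect field `K` of characteristic `p`: the twisted
presentation `Core_K` (for every `M`: normalisations `B^E` of regular integral separated
finite-type `B/K` in finite extensions `E/K(B)` sitting inside `K(B)^{1/p}` — witnessed by a
ring map `β : E → K(B)` with `β ∘ (K(B) → E) = Frobenius` — of `β`-index `[K(B) : β(E)] ≤ p^M`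
are resolvable) implies the degree-`p` residue `DegP_K` (normalisations of regular `W` in purely
inseparable extensions `L/K(W)` of degree `p` are resolvable).

Proof: if `[L : K(W)] = p` and `L/K(W)` is purely inseparable then every `a ∈ L` has minimal
polynomial `X^{p^e} - c` of degree `p^e ≤ p`, so `e ≤ 1` and `a^p ∈ K(W)`: the exponent of
`L/K(W)` is `≤ 1`. Mathlib's `IsPurelyInseparable.iterateFrobenius K(W) L p _ : L →+* K(W)`
(`a ↦ a^p ∈ K(W)`) is then the required `β`, and `Core_K` applies with `M := [K(W) : β(L)]`
(`M ≤ p^M`).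
-/

set_option linter.dupNamespace false

noncomputable section

open CategoryTheory AlgebraicGeometry TopologicalSpace
open Literature.AlgebraicGeometry.Resolution Literature.AlgebraicGeometry.Motives

namespace Summit.ResolutionOfSingularities.ResolutionOfSingularities.Theorems.PalterationThesis.PerfectQuotient

/-- A purely inseparable extension `L/F` of degree `p = expchar F` (a prime) has exponent at
most one: `a ^ p ∈ F` for every `a ∈ L` (the minimal polynomial of `a` is `X^{p^e} - c` of degree
`p^e ≤ [L : F] = p`). [folklore] -/
theorem exponent_le_one_of_finrank_eq {p : ℕ} (hp : p.Prime) (F L : Type*) [Field F] [Field L]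
    [Algebra F L] [ExpChar F p] [IsPurelyInseparable F L] [FiniteDimensional F L]
    (hdeg : Module.finrank F L = p) : IsPurelyInseparable.exponent F L ≤ 1 := by
  by_contra h
  obtain ⟨a, ha⟩ := IsPurelyInseparable.exponent_min' (K := F) p (not_le.mp h)
  apply ha
  have h1 : IsPurelyInseparable.elemExponent F a ≤ 1 := by
    have hle : p ^ IsPurelyInseparable.elemExponent F a ≤ p ^ 1 := by
      rw [← IsPurelyInseparable.minpoly_natDegree_eq' F p a, pow_one, ← hdeg]
      exact minpoly.natDegree_le a
    exact (Nat.pow_le_pow_iff_right hp.one_lt).mp hle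
  obtain ⟨y, hy⟩ := IsPurelyInseparable.elemExponent_def' F p a
  refine ⟨y ^ p ^ (1 - IsPurelyInseparable.elemExponent F a), ?_⟩
  rw [map_pow, hy, ← pow_mul, ← pow_add, Nat.add_sub_cancel' h1]

/-- **Entry of the quotient chain** (stub `stub_degP_of_core`). Over a perfect field `K` of
characteristic `p`, `Core_K` (for every `M`) implies the degree-`p` residue `DegP_K`: for `W`
regular integral separated of finite type over `K` and `L/K(W)` purely inseparable of degree
`p`, the exponent of `L/K(W)` is `≤ 1`, so `β := IsPurelyInseparable.iterateFrobenius K(W) L p _`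
(`x ↦ x^p ∈ K(W)`) is a ring map `L → K(W)` with `β ∘ (K(W) → L) = Frobenius`; apply `Core_K`
with `M := [K(W) : β(L)]`. [cite: Temkin2013, Rem. 1.3.5 (ii)] -/
theorem stub_degP_of_core (p : ℕ) (hp : p.Prime) (K : Type) [Field K] [CharP K p]
    [PerfectField K]
    (hCore : ∀ (M : ℕ) (B : Scheme.{0}) [IsIntegral B] (f : B ⟶ Spec (.of K)),
        IsSeparated f → LocallyOfFiniteType f → QuasiCompact f → Scheme.IsRegular B →
        ∀ (E : Type) [Field E] [Algebra B.functionField E] [FiniteDimensional B.functionField E]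
          (β : E →+* B.functionField),
          (∀ b : B.functionField, β (algebraMap B.functionField E b) = b ^ p) →
          Module.finrank β.fieldRange B.functionField ≤ p ^ M →
          Scheme.HasResolution (normalizationIn B E)) :
    ∀ (W : Scheme.{0}) [IsIntegral W] (f : W ⟶ Spec (.of K)) (L : Type) [Field L]
      [Algebra W.functionField L], IsSeparated f → LocallyOfFiniteType f → QuasiCompact f →
      Scheme.IsRegular W → IsPurelyInseparable W.functionField L →
      Module.finrank W.functionField L = p → Scheme.HasResolution (normalizationIn W L) := by
  intro W _ f L _ _ hsep hlft hqc hreg hPI hdeg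
  haveI : Fact p.Prime := ⟨hp⟩
  haveI : CharP W.functionField p := Picover.TowerTransport.charP_functionField W f
  haveI : ExpChar W.functionField p := ExpChar.prime hp
  haveI : FiniteDimensional W.functionField L :=
    Module.finite_of_finrank_pos (by rw [hdeg]; exact hp.pos)
  have hn : IsPurelyInseparable.exponent W.functionField L ≤ 1 :=
    exponent_le_one_of_finrank_eq hp W.functionField L hdeg
  let β : L →+* W.functionField := IsPurelyInseparable.iterateFrobenius W.functionField L p hn
  have hβ : ∀ b : W.functionField, β (algebraMap W.functionField L b) = b ^ p := fun b =>
    (IsPurelyInseparable.iterateFrobenius_algebraMap L p hn b).trans (by rw [pow_one])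
  exact hCore (Module.finrank β.fieldRange W.functionField) W f hsep hlft hqc hreg L β hβ
    (Nat.lt_pow_self hp.one_lt).le

end Summit.ResolutionOfSingularities.ResolutionOfSingularities.Theorems.PalterationThesis.PerfectQuotient

end
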